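import Mathlib.NumberTheory.LegendreSymbol.QuadraticChar.Basic
import Literature.NumberTheory.NumberFields.AdicCompletionSquareCriteria
import HarnessLib

/-!
# Unit square classes of `K_v` at a non-dyadic place

Topic `NumberTheory/NumberFields`; namespace `Literature.NumberTheory.NumberFields`.  Theorems only (no definition, no named fact),
all fully proved.  For a number field `K`, a finite place `v` with `2 ∉ v` (a NON-DYADIC spot) and `v`-units `x, y ∈ 𝓞 K`
(`x, y ∉ v`):

* `isSquare_residue_of_isSquare_adicCompletion` — **a `v`-unit which is a square in `K_v` is a square modulo `v`** (any `v`):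
  if `c² = x` in `K_v` then `|c|_v = 1`, `c ≡ a (mod 𝔪_v)` for a global integer `a` (density of `𝓞 K` in `𝒪_v`,
  `exists_ringOfIntegers_valued_sub_lt_one`), and `a² ≡ x (mod v)`;
* `isSquare_adicCompletion_of_isSquare_residue` — **the converse at a non-dyadic `v`** (Hensel's lemma for `X² - x` at a unit
  approximate root, `exists_sq_eq_of_sq_sub_mem_maximalIdeal`): O'Meara's Local Square Theorem 63:1a in its unit form;
* `isSquare_adicCompletion_iff_isSquare_residue` — the two together: for `v ∤ 2` the square class of a `v`-unit of `K` in `K_v`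
  is read off in the residue field `𝓞 K ⧸ v`;
* `isSquare_mul_of_not_isSquare_of_not_isSquare` (finite fields of odd characteristic: the product of two non-squares is a
  square — the squares have index `2`; via Mathlib's `quadraticChar`);
* `isSquare_adicCompletion_mul_of_not_isSquare` — **the unit square classes of `K_v` (`v ∤ 2`) form a group of order two**:
  if the `v`-units `x` and `y` are both non-squares in `K_v` then `x y` is a square in `K_v` (O'Meara 63:9: `(𝔬_vˣ : 𝔬_vˣ²) = 2`
  at a non-dyadic spot);
* `isSquare_adicCompletion_trichotomy` — the form used by quadratic PATCHING arguments over the family `K(√-D)`: for rational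
  integers `D₁, D₂` and a place `v ∤ 2 D₁ D₂`, one of `-D₁`, `-D₂`, `D₁ D₂` is a square in `K_v` (so `v` splits in one of
  `K(√-D₁)`, `K(√-D₂)`, `K(√(D₁D₂))`).

## References

* O. T. O'Meara, *Introduction to Quadratic Forms*, Grundlehren 117, Springer (1963), §63A: 63:1a (Local Square Theorem,
  Hensel form), 63:9 (unit square classes at a non-dyadic spot). [Omeara1963]
* J.-P. Serre, *A Course in Arithmetic*, GTM 7, Springer (1973), Ch. II §3.3 (squares in `ℚ_pˣ`, `p` odd). [Serre1973]
* J. W. S. Cassels, *Local Fields*, LMS Student Texts 3 (1986), Ch. 4 Lemma 3.1 (Hensel). [Cassels1986]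
-/

noncomputable section

open scoped NumberField Valued
open NumberField IsDedekindDomain

namespace Literature.NumberTheory.NumberFields

open Literature.NumberTheory.GaloisRepresentations Literature.NumberTheory.Automorphic

variable {K : Type*} [Field K] [NumberField K]

/-! ### From `K_v` to the residue field (any place) -/

/-- **A `v`-unit of `𝓞 K` which is a square in `K_v` is a square in the residue field `𝓞 K ⧸ v`** (O'Meara §63A; the
argument of 63:2): a square root `c ∈ K_v` is a `v`-adic unit, is approximated modulo `𝔪_v` by a global integer `a`
(`𝓞 K` is dense in `𝒪_v`), and then `a² ≡ x (mod v)`. [cite: Omeara1963, §63A 63:2] -/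
theorem isSquare_residue_of_isSquare_adicCompletion (v : HeightOneSpectrum (𝓞 K)) {x : 𝓞 K}
    (hx : x ∉ v.asIdeal) (hsq : IsSquare (algebraMap K (v.adicCompletion K) (algebraMap (𝓞 K) K x))) :
    IsSquare (Ideal.Quotient.mk v.asIdeal x) := by
  classical
  obtain ⟨c, hc⟩ := hsq
  have hval : ∀ r : K, Valued.v (algebraMap K (v.adicCompletion K) r) = v.valuation K r :=
    fun r => HeightOneSpectrum.valuedAdicCompletion_eq_valuation' v r
  set X : v.adicCompletion K := algebraMap K (v.adicCompletion K) (algebraMap (𝓞 K) K x) with hX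
  -- `|x|_v = |c|_v = 1`
  have hvx : Valued.v X = 1 := by
    rw [hX, hval, HeightOneSpectrum.valuation_of_algebraMap]
    exact HeightOneSpectrum.intValuation_eq_one_iff.2 hx
  have hcc : c * c = X := hc.symm
  have hvc : Valued.v c = 1 := by
    have hcp : Valued.v c ^ 2 = 1 := by rw [← map_pow, sq, hcc, hvx]
    rcases lt_trichotomy (Valued.v c) 1 with h | h | h
    · exact absurd hcp (pow_lt_one₀ zero_le h two_ne_zero).ne
    · exact h
    · exact absurd hcp (one_lt_pow₀ h two_ne_zero).ne'
  -- approximate `c` by a global integer `a`: then `a² ≡ x (mod v)`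
  obtain ⟨a, ha⟩ := exists_ringOfIntegers_valued_sub_lt_one K v
    ⟨c, (Valuation.mem_valuationSubring_iff _ _).2 hvc.le⟩
  set A : v.adicCompletion K := algebraMap K (v.adicCompletion K) (algebraMap (𝓞 K) K a) with hA
  change Valued.v (A - c) < 1 at ha
  have hvA : Valued.v A ≤ 1 := by
    rw [hA, hval]
    exact HeightOneSpectrum.valuation_le_one v a
  have hmem : a ^ 2 - x ∈ v.asIdeal := by
    rw [← HeightOneSpectrum.valuation_lt_one_iff_mem (K := K), ← hval]
    have h : algebraMap K (v.adicCompletion K) (algebraMap (𝓞 K) K (a ^ 2 - x)) =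
        (A - c) * (A + c) := by
      rw [map_sub, map_pow, map_sub, map_pow, ← hA, ← hX, ← hcc]
      ring
    rw [h, map_mul]
    have hAc : Valued.v (A + c) ≤ 1 := le_trans (Valuation.map_add _ _ _) (max_le hvA hvc.le)
    calc Valued.v (A - c) * Valued.v (A + c) ≤ Valued.v (A - c) * 1 := mul_le_mul_right hAc _
      _ < 1 := by rw [mul_one]; exact ha
  refine ⟨Ideal.Quotient.mk v.asIdeal a, ?_⟩
  rw [← map_mul, ← sq, eq_comm, Ideal.Quotient.eq]
  exact hmem

/-! ### From the residue field to `K_v` (non-dyadic place, Hensel) -/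

/-- **A `v`-unit which is a square modulo a NON-DYADIC `v` is a square in `K_v`** (O'Meara 63:1a, Local Square Theorem in
Hensel form; Cassels Ch. 4 Lemma 3.1): if `a² ≡ x (mod v)` with `x ∉ v` then `a ∉ v`, so `a` is a unit approximate root of
`X² - x` in the Henselian ring `𝒪_v`, where `2` is a unit since `2 ∉ v`. [cite: Omeara1963, §63A 63:1a] -/
theorem isSquare_adicCompletion_of_isSquare_residue (v : HeightOneSpectrum (𝓞 K)) (h2 : (2 : 𝓞 K) ∉ v.asIdeal)
    {x : 𝓞 K} (hx : x ∉ v.asIdeal) (hsq : IsSquare (Ideal.Quotient.mk v.asIdeal x)) :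
    IsSquare (algebraMap K (v.adicCompletion K) (algebraMap (𝓞 K) K x)) := by
  classical
  haveI : HenselianLocalRing 𝒪[v.adicCompletion K] :=
    inferInstanceAs (HenselianLocalRing (v.adicCompletionIntegers K))
  have hint : (Valued.v (R := v.adicCompletion K)).Integers 𝒪[v.adicCompletion K] :=
    Valuation.integer.integers _
  have hval : ∀ r : K, Valued.v (algebraMap K (v.adicCompletion K) r) = v.valuation K r :=
    fun r => HeightOneSpectrum.valuedAdicCompletion_eq_valuation' v r
  -- the global integers as elements of `𝒪_v`
  have hle : ∀ b : 𝓞 K, Valued.v (algebraMap K (v.adicCompletion K) (algebraMap (𝓞 K) K b)) ≤ 1 := fun b => by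
    rw [hval]; exact HeightOneSpectrum.valuation_le_one v b
  let ι : 𝓞 K → 𝒪[v.adicCompletion K] := fun b =>
    ⟨algebraMap K (v.adicCompletion K) (algebraMap (𝓞 K) K b), (Valuation.mem_valuationSubring_iff _ _).2 (hle b)⟩
  have hιv : ∀ b : 𝓞 K, Valued.v ((ι b : 𝒪[v.adicCompletion K]) : v.adicCompletion K) = v.intValuation b := fun b => by
    change Valued.v (algebraMap K (v.adicCompletion K) (algebraMap (𝓞 K) K b)) = _
    rw [hval, HeightOneSpectrum.valuation_of_algebraMap]
  have hunit : ∀ b : 𝓞 K, b ∉ v.asIdeal → IsUnit (ι b) := fun b hb => by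
    rw [hint.isUnit_iff_valuation_eq_one]
    change Valued.v ((ι b : 𝒪[v.adicCompletion K]) : v.adicCompletion K) = 1
    rw [hιv]
    exact HeightOneSpectrum.intValuation_eq_one_iff.2 hb
  have hmax : ∀ b : 𝓞 K, b ∈ v.asIdeal → ι b ∈ IsLocalRing.maximalIdeal 𝒪[v.adicCompletion K] := fun b hb => by
    rw [IsLocalRing.mem_maximalIdeal, mem_nonunits_iff, hint.isUnit_iff_valuation_eq_one]
    change ¬ Valued.v ((ι b : 𝒪[v.adicCompletion K]) : v.adicCompletion K) = 1
    rw [hιv]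
    exact ne_of_lt ((HeightOneSpectrum.intValuation_lt_one_iff_mem v b).2 hb)
  -- `ι` is compatible with the ring operations we need
  have hι_sub : ∀ b b' : 𝓞 K, ι (b - b') = ι b - ι b' := fun b b' => by
    apply Subtype.ext; change algebraMap K _ (algebraMap (𝓞 K) K (b - b')) = _; simp [ι]
  have hι_sq : ∀ b : 𝓞 K, ι (b ^ 2) = ι b ^ 2 := fun b => by
    apply Subtype.ext; change algebraMap K _ (algebraMap (𝓞 K) K (b ^ 2)) = _; simp [ι]
  -- `2 ∈ 𝒪_vˣ`
  have hvalO : ∀ n : ℤ, Valued.v (((n : 𝒪[v.adicCompletion K]) : v.adicCompletion K)) =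
      v.intValuation (n : 𝓞 K) := fun n => by
    rw [← valued_intCast_adicCompletion v n]
    simp
  have h2v : ((2 : ℤ) : 𝓞 K) ∉ v.asIdeal := by simpa using h2
  have hu2 : IsUnit (2 : 𝒪[v.adicCompletion K]) := by
    rw [hint.isUnit_iff_valuation_eq_one]
    change Valued.v (((((2 : ℤ) : 𝒪[v.adicCompletion K])) : v.adicCompletion K)) = 1
    rw [hvalO]
    exact HeightOneSpectrum.intValuation_eq_one_iff.2 h2v
  -- an approximate root `a`
  obtain ⟨r, hr⟩ := hsq
  obtain ⟨a, rfl⟩ := Ideal.Quotient.mk_surjective r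
  have hmem : a ^ 2 - x ∈ v.asIdeal := by
    rw [← Ideal.Quotient.eq, map_pow, sq]; exact hr.symm
  have ha : a ∉ v.asIdeal := fun ha => hx (by
    have h2 : a ^ 2 ∈ v.asIdeal := by rw [sq]; exact Ideal.mul_mem_left _ _ ha
    simpa using Ideal.sub_mem _ h2 hmem)
  have hc : ι a ^ 2 - ι x ∈ IsLocalRing.maximalIdeal 𝒪[v.adicCompletion K] := by
    rw [← hι_sq, ← hι_sub]; exact hmax _ hmem
  obtain ⟨z, hz⟩ := exists_sq_eq_of_sq_sub_mem_maximalIdeal hu2 (hunit a ha) hc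
  refine ⟨(z : v.adicCompletion K), ?_⟩
  have hz' : ((z : v.adicCompletion K)) ^ 2 = ((ι x : 𝒪[v.adicCompletion K]) : v.adicCompletion K) := by
    have h := congrArg (fun t : 𝒪[v.adicCompletion K] => (t : v.adicCompletion K)) hz
    simpa using h
  rw [← sq, hz']

/-- **At a non-dyadic place the square class of a `v`-unit in `K_v` is read off in the residue field**: for `2 ∉ v` and
`x ∉ v`, `x ∈ K_v²` iff `x̄ ∈ (𝓞 K ⧸ v)²` (O'Meara 63:1a with 63:2). [cite: Omeara1963, §63A 63:1a] -/
theorem isSquare_adicCompletion_iff_isSquare_residue (v : HeightOneSpectrum (𝓞 K)) (h2 : (2 : 𝓞 K) ∉ v.asIdeal)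
    {x : 𝓞 K} (hx : x ∉ v.asIdeal) :
    IsSquare (algebraMap K (v.adicCompletion K) (algebraMap (𝓞 K) K x)) ↔ IsSquare (Ideal.Quotient.mk v.asIdeal x) :=
  ⟨isSquare_residue_of_isSquare_adicCompletion v hx, isSquare_adicCompletion_of_isSquare_residue v h2 hx⟩

/-! ### Finite fields of odd characteristic: non-square times non-square is a square -/

/-- In a finite field in which `2 ≠ 0`, the product of two non-squares is a square (the squares of `Fˣ` have index `2`;
Mathlib's quadratic character is multiplicative with values `±1` on `Fˣ`). Serre, *A Course in Arithmetic*, Ch. I §3.1.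
[cite: Serre1973, Ch. I §3.1] -/
theorem isSquare_mul_of_not_isSquare_of_not_isSquare {F : Type*} [Field F] [Fintype F]
    {a b : F} (ha : ¬ IsSquare a) (hb : ¬ IsSquare b) : IsSquare (a * b) := by
  classical
  have ha0 : a ≠ 0 := fun h => ha (h ▸ IsSquare.zero)
  have hb0 : b ≠ 0 := fun h => hb (h ▸ IsSquare.zero)
  have hχa : quadraticChar F a = -1 := (quadraticChar_neg_one_iff_not_isSquare).2 ha
  have hχb : quadraticChar F b = -1 := (quadraticChar_neg_one_iff_not_isSquare).2 hb
  have hχ : quadraticChar F (a * b) = 1 := by rw [map_mul, hχa, hχb]; norm_num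
  exact (quadraticChar_one_iff_isSquare (mul_ne_zero ha0 hb0)).1 hχ

/-! ### Unit square classes at a non-dyadic place -/

/-- **The unit square classes of `K_v` at a non-dyadic place form a group of order two** (O'Meara 63:9): if the `v`-units
`x, y ∈ 𝓞 K` (`2, x, y ∉ v`) are both non-squares in `K_v`, then `x y` is a square in `K_v` — read off in the finite residue
field `𝓞 K ⧸ v` of odd characteristic. [cite: Omeara1963, §63A 63:9] -/
theorem isSquare_adicCompletion_mul_of_not_isSquare (v : HeightOneSpectrum (𝓞 K)) (h2 : (2 : 𝓞 K) ∉ v.asIdeal)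
    {x y : 𝓞 K} (hx : x ∉ v.asIdeal) (hy : y ∉ v.asIdeal)
    (hxs : ¬ IsSquare (algebraMap K (v.adicCompletion K) (algebraMap (𝓞 K) K x)))
    (hys : ¬ IsSquare (algebraMap K (v.adicCompletion K) (algebraMap (𝓞 K) K y))) :
    IsSquare (algebraMap K (v.adicCompletion K) (algebraMap (𝓞 K) K (x * y))) := by
  classical
  haveI : v.asIdeal.IsMaximal := v.isMaximal
  letI : Field (𝓞 K ⧸ v.asIdeal) := Ideal.Quotient.field v.asIdeal
  haveI : Finite (𝓞 K ⧸ v.asIdeal) := Ideal.finiteQuotientOfFreeOfNeBot _ v.ne_bot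
  letI : Fintype (𝓞 K ⧸ v.asIdeal) := Fintype.ofFinite _
  have hxy : x * y ∉ v.asIdeal := fun h => (v.isPrime.mem_or_mem h).elim hx hy
  have hxr : ¬ IsSquare (Ideal.Quotient.mk v.asIdeal x) :=
    fun h => hxs (isSquare_adicCompletion_of_isSquare_residue v h2 hx h)
  have hyr : ¬ IsSquare (Ideal.Quotient.mk v.asIdeal y) :=
    fun h => hys (isSquare_adicCompletion_of_isSquare_residue v h2 hy h)
  have hprod : IsSquare (Ideal.Quotient.mk v.asIdeal x * Ideal.Quotient.mk v.asIdeal y) :=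
    isSquare_mul_of_not_isSquare_of_not_isSquare (F := 𝓞 K ⧸ v.asIdeal) hxr hyr
  refine isSquare_adicCompletion_of_isSquare_residue v h2 hxy ?_
  rw [map_mul]
  exact hprod

/-- **Trichotomy for quadratic patching families**: for integers `D₁, D₂` and a place `v` with `2, D₁, D₂ ∉ v`, one of
`-D₁`, `-D₂`, `D₁ D₂` is a square in `K_v` (so `v` splits completely in one of `K(√-D₁)`, `K(√-D₂)`, `K(√(D₁ D₂))`).
Immediate from `isSquare_adicCompletion_mul_of_not_isSquare` with `x = -D₁`, `y = -D₂`. O'Meara 63:9; used in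
Sorensen-type patching over the family `K(√-D)` (Sorensen 2020 §1 Example). [cite: Omeara1963, §63A 63:9] -/
theorem isSquare_adicCompletion_trichotomy (v : HeightOneSpectrum (𝓞 K)) (h2 : (2 : 𝓞 K) ∉ v.asIdeal)
    {D₁ D₂ : ℤ} (hD₁ : ((D₁ : ℤ) : 𝓞 K) ∉ v.asIdeal) (hD₂ : ((D₂ : ℤ) : 𝓞 K) ∉ v.asIdeal) :
    IsSquare (algebraMap K (v.adicCompletion K) (-(D₁ : K))) ∨
      IsSquare (algebraMap K (v.adicCompletion K) (-(D₂ : K))) ∨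
        IsSquare (algebraMap K (v.adicCompletion K) ((D₁ : K) * (D₂ : K))) := by
  classical
  by_cases h₁ : IsSquare (algebraMap K (v.adicCompletion K) (-(D₁ : K)))
  · exact Or.inl h₁
  by_cases h₂ : IsSquare (algebraMap K (v.adicCompletion K) (-(D₂ : K)))
  · exact Or.inr (Or.inl h₂)
  refine Or.inr (Or.inr ?_)
  have hx : (-(D₁ : 𝓞 K)) ∉ v.asIdeal := fun h => hD₁ ((Ideal.neg_mem_iff _).1 h)
  have hy : (-(D₂ : 𝓞 K)) ∉ v.asIdeal := fun h => hD₂ ((Ideal.neg_mem_iff _).1 h)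
  have e₁ : algebraMap (𝓞 K) K (-(D₁ : 𝓞 K)) = -(D₁ : K) := by simp
  have e₂ : algebraMap (𝓞 K) K (-(D₂ : 𝓞 K)) = -(D₂ : K) := by simp
  have e : algebraMap (𝓞 K) K (-(D₁ : 𝓞 K) * -(D₂ : 𝓞 K)) = (D₁ : K) * (D₂ : K) := by simp
  have h := isSquare_adicCompletion_mul_of_not_isSquare v h2 hx hy (by rwa [e₁]) (by rwa [e₂])
  rwa [e] at h

end Literature.NumberTheory.NumberFields

end
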